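import Summits.CriticalPhenomena.PercolationContinuityZ3.Theorems.PercNearOneGluingNoHeavyQuantGatedSliceMixLawA5Cells
import Summits.CriticalPhenomena.PercolationContinuityZ3.Theorems.PercNearOneGluingNoHeavyQuantGatedSliceMixLawRegimeBCells
import HarnessLib

/-!
# QUANT lane R8, T-DEC, leg (III), blob case — the residual corner `MixLawCellA5r` of the regime-A mixture cell IS A SUB-CELL of census-2's
# regime-B P-alone cell `MixLawCellPDear`: ONE scalar lemma closes both

builds on p205010 (kernel theorem, internal audit signed; external expert review pending)

Support file (`--supports stmt-CriticalPhenomena-4575`), QUANT lane lead seat prim-quant-lead (gen 33), rung R8 of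
`run/shared/lean/prim/quant/LADDER.md`.  Lead g33 RULING (README V334): the P-alone statements do not see the weak-mid atom `h`, so the
regime-A residual (`MixLawCellA5r`, `…QuantGatedSliceMixLawA5Cells`: heavy pair, `k₁ < ag(1−z)`, shifted low light, big bracket) and the
regime-B cell `MixLawCellPDear` (`…QuantGatedSliceMixLawRegimeBCells`: heavy pair, unsaturated mid — nothing else) are the SAME statement up to
extra hypotheses on the A-side; the binder of `MixLawCellPDear` is contained in that of `MixLawCellA5r` clause for clause.  Hence arm-2 g36's
reduction of `MixLawCellPDear` to the inequality (I_{U₁}) on the thin regime (`mixLawCellPDear_of_thinKink`, `…QuantGatedSliceMixLawPDearThin`)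
closes cell A5 as well, and conversely the lead's load-bound route (`…QuantGatedSliceMixLawA5Fill`) is a route to `MixLawCellPDear` on the
A5r corner.  One theorem, standard axioms, no sorries.

* **`LawDec.mixLawCellA5r_of_PDear : MixLawCellPDear → MixLawCellA5r`**.

[this work]; cells: census-2 g61 (PDear), lead g33 (A5r).  The gluing rows served [cite: KozmaNitzan2024, Conjecture 3 (p. 15)]; product measure
[cite: Grimmett1999, §1.3 p. 10].
-/

noncomputable section

namespace Summit.CriticalPhenomena.PercolationContinuityZ3.Theorems

namespace Quant

namespace LawDec

/-- **`MixLawCellPDear ⟹ MixLawCellA5r`** (binder inclusion: `k₁ ≤ j` from `k₁ + a ≤ j`, `2k₁ < t` from `2(k₁+a) < t`; the A5r-only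
hypotheses are dropped). [this work] -/
theorem mixLawCellA5r_of_PDear (hP : MixLawCellPDear) : MixLawCellA5r := by
  intro y z g S lam a j M k₁ k₂ hy0 hy1 hz0 hz1 hg1 hyg ha hjM hS0 hta hSj hSM hk hk₂M hlam0 hlam1 hmean _hk₁ hllow hlj hk₂j hk₂mid
    hcompl hk₂aG hunsat _hfull _hcomp₁ hheavy _hsmall _hlight _hbr
  have hk₁j : k₁ ≤ j := by omega
  have hk1low : 2 * (k₁ : ℝ) < S + (a : ℝ) * g * (1 - z) := by
    push_cast at hllow
    have : (0 : ℝ) ≤ a := Nat.cast_nonneg a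
    linarith
  exact hP y z g S lam a j M k₁ k₂ hy0 hy1 hz0 hz1 hg1 hyg ha hjM hS0 hta hSj hSM hk hk₂M hlam0 hlam1 hmean hk₁j hk1low hlj hllow
    hk₂j hk₂mid hcompl hk₂aG hheavy hunsat

end LawDec

end Quant

end Summit.CriticalPhenomena.PercolationContinuityZ3.Theorems
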